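import Literature.Probability.Percolation.PercolationEvents
import Mathlib.Data.Finset.Card
import Mathlib.Order.UpperLower.Basic
import HarnessLib

/-!
# One-step scheme: the `H`-hull of an increasing event at codimension `c` is the TRANSVERSAL EVENT of its bad sets of size `≤ c`

Support file (prover prim-ineq-prove-3 gen 37; `--supports stmt-CriticalPhenomena-4575`; memo
`run/shared/lean/prim/prim-ineq-prove-3/FINDING-G37-TOP-THREE-LAYERS.md` §5).  No definitions, no named facts, no sorries.

For the slot `H = {N_F ≥ |F| - c}` and an `F`-determined event `B`, the `H`-generated hull
`B* = {ω | every ω' ⊇ ω with ω' ∈ H lies in B}` (as in `osN_ind_ind_hgen_le_right`) is the event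
"`ω` meets every BAD set", where `T ⊆ F` is bad when `|T| ≤ c` and the configuration `F ∖ T` is not in `B`:
`hgen_threshold_codim_eq`.  (Codimension 2 in vertex-cover format: `hgen_threshold_codimTwo_eq` of `…SahiOneStepTwoCNF`.)  So the codim-`c` hull
is a monotone CNF of clause width `≤ c`; its unit clauses are the bad singletons, and "no bad set of size `< c`" means `B ⊇ {N_F ≥ |F| - c + 1}`.
-/

namespace Summit.CriticalPhenomena.PercolationContinuityZ3.Theorems

namespace SahiOneStep

open Finset
open scoped Classical
open Literature.Probability.Percolation (DeterminedBy determinedBy_iff)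

variable {ι : Type*}

/-- **Hull = transversal event of the bad sets.**  For an `F`-determined `B` and `c : ℕ`:
`{ω | ∀ ω' ⊇ ω, |F| - c ≤ N_F(ω') → ω' ∈ B} = {ω | ∀ T ⊆ F, |T| ≤ c → F ∖ T ∉ B → ∃ i ∈ T, i ∈ ω}`. [this work] -/
theorem hgen_threshold_codim_eq (F : Finset ι) (c : ℕ) {B : Set (Set ι)} (hBF : DeterminedBy B (↑F : Set ι)) :
    {ω : Set ι | ∀ ω' : Set ι, ω ⊆ ω' → ω' ∈ {ω : Set ι | F.card - c ≤ (F.filter (· ∈ ω)).card} → ω' ∈ B} =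
      {ω : Set ι | ∀ T : Finset ι, T ⊆ F → T.card ≤ c → (↑(F \ T) : Set ι) ∉ B → ∃ i ∈ T, i ∈ ω} := by
  rw [determinedBy_iff] at hBF
  ext ω
  simp only [Set.mem_setOf_eq]
  constructor
  · intro hω T hTF hTc hbad
    by_contra hno
    push Not at hno
    apply hbad
    -- `ω' = (↑T)ᶜ` lies above `ω`, is in the slot, hence in `B`, and agrees with `F ∖ T` on `F`
    have hsub : ω ⊆ (↑T : Set ι)ᶜ := fun j hj hjT => hno j (Finset.mem_coe.1 hjT) hj
    have hmem : (↑T : Set ι)ᶜ ∈ B := by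
      refine hω _ hsub (le_trans ?_ (Finset.card_le_card (s := F \ T) fun j hj => ?_))
      · have := Finset.card_sdiff_add_card_eq_card hTF
        omega
      · rw [Finset.mem_sdiff] at hj
        simp only [Finset.mem_filter, Set.mem_compl_iff, Finset.mem_coe]
        exact hj
    have hagree : (↑T : Set ι)ᶜ ∩ ↑F = (↑(F \ T) : Set ι) ∩ ↑F := by
      ext j
      simp only [Set.mem_inter_iff, Set.mem_compl_iff, Finset.mem_coe, Finset.mem_sdiff]
      tauto
    rwa [hBF _ _ hagree] at hmem
  · intro hω ω' hle hH
    -- the missed set `T = F ∖ ω'` has at most `c` elements; if it were bad, `ω ⊆ ω'` would meet it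
    set T := F.filter (· ∉ ω') with hT
    have hTc : T.card ≤ c := by
      have := Finset.card_filter_add_card_filter_not (s := F) (fun i => i ∈ ω')
      rw [hT]; omega
    have hagree : ω' ∩ (↑F : Set ι) = (↑(F \ T) : Set ι) ∩ ↑F := by
      ext j
      simp only [Set.mem_inter_iff, Finset.mem_coe, Finset.mem_sdiff, hT, Finset.mem_filter, not_and, not_not]
      tauto
    rw [hBF ω' _ hagree]
    by_contra hbad
    obtain ⟨i, hiT, hiω⟩ := hω T (Finset.filter_subset _ _) hTc hbad
    exact (Finset.mem_filter.1 hiT).2 (hle hiω)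

/-- The transversal event of the bad sets contains `B` itself (for `B` increasing and `F`-determined) — the hull is above the event. [this work] -/
theorem subset_transversal_bad (F : Finset ι) (c : ℕ) {B : Set (Set ι)} (hB : IsUpperSet B) (hBF : DeterminedBy B (↑F : Set ι)) :
    B ⊆ {ω : Set ι | ∀ T : Finset ι, T ⊆ F → T.card ≤ c → (↑(F \ T) : Set ι) ∉ B → ∃ i ∈ T, i ∈ ω} := by
  intro ω hω T hTF _ hbad
  by_contra hno
  push Not at hno
  apply hbad
  rw [determinedBy_iff] at hBF
  have h1 : ω ∩ (↑F : Set ι) ∈ B := by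
    rw [← hBF ω (ω ∩ ↑F) (by rw [Set.inter_assoc, Set.inter_self])]; exact hω
  refine hB (fun j hj => ?_) h1
  rw [Finset.mem_coe, Finset.mem_sdiff]
  exact ⟨Finset.mem_coe.1 hj.2, fun hjT => hno j hjT hj.1⟩

end SahiOneStep

end Summit.CriticalPhenomena.PercolationContinuityZ3.Theorems
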